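import Literature.Barriers.FinalStateConjecture.KleinGordonModeConstruction
import Literature.Analysis.SpecialFunctions.SpheroidalHarmonicEigenfunction
import HarnessLib

/-!
# Angular modes for the Klein–Gordon mode construction: from a zero of the spheroidal shooting
# function to `IsAngularSolution` and `IsSphericalExtension`

Topic `Literature/Barriers/FinalStateConjecture`. The angular half of the data demanded by
`ShlapentokhRothman2014_separatedMode` (SR, CMP 329 (2014), Thm. 1.2 at the ODE level): given
`m ∈ ℤ ∖ {0}`, complex `ω`, a mass `μ`, and a zero `ν` of the spheroidal shooting function
`F(ν, κ) = q'(1; |m|, ν, κ)` at spheroidicity `κ = a²(ω² − μ²)`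
(`Literature.Analysis.SpecialFunctions.sphmDer |m| ν κ 1 = 0`; such zeros are produced in
`SpheroidalHarmonicLegendre/Branch/Eigencurve.lean`), the function
`S(θ) = sin^{|m|} θ · E(cos θ)` of `SpheroidalHarmonicEigenfunction.lean` is an angular solution
in the sense of `IsAngularSolution a ω μ m Λ S` with `Λ = ν + |m|(|m|+1)` (SR (2.1) with genuine
derivatives on `(0, π)`), it does not vanish identically, and
`Y(v) = ((v₀ ± i v₁)/‖v‖)^{|m|} E(v₂/‖v‖)` (sign `= sign m`) is a `C^∞`, degree-`0` homogeneous
function on `ℝ³ ∖ {0}` restricting to `e^{imφ} S(θ)` on the unit sphere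
(`IsSphericalExtension m S Y`) — i.e. `e^{imφ} S` extends smoothly to `𝕊²`
(`angularData_of_shooting_zero`). All proved.

## References

* Y. Shlapentokh-Rothman, Comm. Math. Phys. 329 (2014) 859–891, §2 (2.1), App. B.
  Key `ShlapentokhRothman2014KleinGordon`.
-/

noncomputable section

open Set Filter
open scoped Topology Real ContDiff

namespace Literature.Barriers.FinalStateConjecture

open Literature.Geometry.Lorentzian Literature.Analysis.SpecialFunctions Literature.Analysis.ODE

/-! ### Coordinates and the norm on `E3 ∖ {0}` -/

/-- The coordinate functions on `E3` are smooth. [folklore] -/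
theorem contDiff_coord (i : Fin 3) : ContDiff ℝ ∞ (fun v : E3 ↦ v i) := by
  have h := (EuclideanSpace.proj (𝕜 := ℝ) (ι := Fin 3) i).contDiff (n := ∞)
  exact h

/-- `|v₂| ≤ ‖v‖` on `E3`. [folklore] -/
theorem abs_coord_two_le_norm (v : E3) : |v 2| ≤ ‖v‖ := by
  have h := E3.norm_sq v
  have h2 : (v 2) ^ 2 ≤ ‖v‖ ^ 2 := by nlinarith [sq_nonneg (v 0), sq_nonneg (v 1)]
  exact abs_le_of_sq_le_sq' h2 (norm_nonneg v) |>.elim (fun h1 h3 ↦ abs_le.2 ⟨h1, h3⟩)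

/-- The latitude coordinate `v₂/‖v‖ ∈ [−1, 1] ⊂ (−9/4, 9/4)` for `v ≠ 0`. [folklore] -/
theorem coord_two_div_norm_mem {v : E3} (hv : v ≠ 0) : v 2 / ‖v‖ ∈ Ioo (-9 / 4 : ℝ) (9 / 4) := by
  have hn : 0 < ‖v‖ := norm_pos_iff.2 hv
  have h := abs_coord_two_le_norm v
  rw [abs_le] at h
  constructor
  · rw [lt_div_iff₀ hn]; linarith
  · rw [div_lt_iff₀ hn]; linarith

/-! ### The Cartesian extension `Y` -/

/-- The phase `(v₀ + i s v₁)/‖v‖` (`s = ±1`), equal to `sin θ · e^{i s φ}` on the unit sphere.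
[folklore] -/
def angPhase (s : ℝ) (v : E3) : ℂ := ((v 0 / ‖v‖ : ℝ) : ℂ) + (s : ℂ) * Complex.I * ((v 1 / ‖v‖ : ℝ) : ℂ)

/-- **The Cartesian form of `e^{imφ} S(θ)`**: `Y(v) = ((v₀ + i s v₁)/‖v‖)^{m₀} · E(v₂/‖v‖)` with
`m₀ = |m|`, `s = sign m`, `E` the even spheroidal eigenfunction in the latitude variable.
[cite: ShlapentokhRothman2014KleinGordon, §2] -/
def angY (m₀ : ℕ) (s : ℝ) (ν κ : ℂ) (v : E3) : ℂ := angPhase s v ^ m₀ * sphmEig m₀ ν κ (v 2 / ‖v‖)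

/-- The phase is smooth off the origin. [folklore] -/
theorem contDiffAt_angPhase (s : ℝ) {v : E3} (hv : v ≠ 0) : ContDiffAt ℝ ∞ (angPhase s) v := by
  have hn : ContDiffAt ℝ ∞ (fun w : E3 ↦ ‖w‖) v := contDiffAt_norm ℝ hv
  have hn0 : ‖v‖ ≠ 0 := norm_ne_zero_iff.2 hv
  have h0 : ContDiffAt ℝ ∞ (fun w : E3 ↦ w 0 / ‖w‖) v := (contDiff_coord 0).contDiffAt.div hn hn0
  have h1 : ContDiffAt ℝ ∞ (fun w : E3 ↦ w 1 / ‖w‖) v := (contDiff_coord 1).contDiffAt.div hn hn0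
  unfold angPhase
  exact (Complex.ofRealCLM.contDiff.contDiffAt.comp v h0).add
    (contDiffAt_const.mul (Complex.ofRealCLM.contDiff.contDiffAt.comp v h1))

/-- **`Y` is `C^∞` on `E3 ∖ {0}`** (for a zero of the shooting function). [cite: ShlapentokhRothman2014KleinGordon, §2] -/
theorem contDiffOn_angY {m₀ : ℕ} {ν κ : ℂ} (hg : sphmDer m₀ ν κ 1 = 0) (s : ℝ) :
    ContDiffOn ℝ ∞ (angY m₀ s ν κ) {n : E3 | n ≠ 0} := by
  intro v hv
  have hv' : v ≠ 0 := hv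
  have hn : ContDiffAt ℝ ∞ (fun w : E3 ↦ ‖w‖) v := contDiffAt_norm ℝ hv'
  have hn0 : ‖v‖ ≠ 0 := norm_ne_zero_iff.2 hv'
  have h2 : ContDiffAt ℝ ∞ (fun w : E3 ↦ w 2 / ‖w‖) v := (contDiff_coord 2).contDiffAt.div hn hn0
  have hE : ContDiffAt ℝ ∞ (sphmEig m₀ ν κ) (v 2 / ‖v‖) := contDiffAt_sphmEig hg (coord_two_div_norm_mem hv') le_rfl
  have hcomp : ContDiffAt ℝ ∞ ((sphmEig m₀ ν κ) ∘ (fun w : E3 ↦ w 2 / ‖w‖)) v := hE.comp v h2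
  exact (((contDiffAt_angPhase s hv').pow m₀).mul hcomp).contDiffWithinAt

/-- **`Y` is homogeneous of degree `0`.** [folklore] -/
theorem angY_smul (m₀ : ℕ) (s : ℝ) (ν κ : ℂ) {v : E3} (hv : v ≠ 0) {t : ℝ} (ht : 0 < t) :
    angY m₀ s ν κ (t • v) = angY m₀ s ν κ v := by
  have hn : 0 < ‖v‖ := norm_pos_iff.2 hv
  have hnorm : ‖t • v‖ = t * ‖v‖ := by rw [norm_smul, Real.norm_eq_abs, abs_of_pos ht]
  have hc : ∀ i : Fin 3, (t • v) i / ‖t • v‖ = v i / ‖v‖ := fun i ↦ by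
    rw [hnorm, show (t • v) i = t * v i by simp]
    field_simp
  unfold angY angPhase
  rw [hc 0, hc 1, hc 2]

/-- The norm of the unit radial vector is `1`. [folklore] -/
theorem norm_sphRadial (θ φ : ℝ) : ‖sphRadial θ φ‖ = 1 := by
  have h := E3.norm_sq (sphRadial θ φ)
  rw [sphRadial_apply_zero, sphRadial_apply_one, sphRadial_apply_two] at h
  have h1 : ‖sphRadial θ φ‖ ^ 2 = 1 := by
    rw [h]
    nlinarith [Real.sin_sq_add_cos_sq φ, Real.sin_sq_add_cos_sq θ]
  have h0 : 0 ≤ ‖sphRadial θ φ‖ := norm_nonneg _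
  nlinarith [h1, h0]

/-- The phase on the unit sphere: `(cos φ sin θ) + i s (sin φ sin θ) = sin θ · e^{i s φ}` for
`s = ±1`. [folklore] -/
theorem angPhase_sphRadial {s : ℝ} (hs : s = 1 ∨ s = -1) (θ φ : ℝ) :
    angPhase s (sphRadial θ φ) = (Real.sin θ : ℂ) * Complex.exp (((s * φ : ℝ) : ℂ) * Complex.I) := by
  unfold angPhase
  rw [norm_sphRadial, div_one, div_one, sphRadial_apply_zero, sphRadial_apply_one, Complex.exp_mul_I,
    ← Complex.ofReal_cos, ← Complex.ofReal_sin]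
  rcases hs with h | h
  · subst h
    rw [one_mul]
    push_cast
    ring
  · subst h
    rw [show (-1 : ℝ) * φ = -φ by ring, Real.cos_neg, Real.sin_neg]
    push_cast
    ring

/-- **Restriction of `Y` to the unit sphere**: `Y(n̂(θ, φ)) = e^{imφ} S(θ)` with
`S = sin^{m₀} θ · E(cos θ)`, `m = s m₀`. [cite: ShlapentokhRothman2014KleinGordon, §2] -/
theorem angY_sphRadial (m₀ : ℕ) {s : ℝ} (hs : s = 1 ∨ s = -1) (ν κ : ℂ) (θ φ : ℝ) :
    angY m₀ s ν κ (sphRadial θ φ) =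
      Complex.exp ((((s * m₀) * φ : ℝ) : ℂ) * Complex.I) * sphmAng m₀ ν κ θ := by
  unfold angY sphmAng
  rw [angPhase_sphRadial hs, norm_sphRadial, div_one, sphRadial_apply_two, mul_pow]
  have key : Complex.exp (((s * φ : ℝ) : ℂ) * Complex.I) ^ m₀ = Complex.exp ((((s * m₀) * φ : ℝ) : ℂ) * Complex.I) := by
    rw [← Complex.exp_nat_mul]
    congr 1
    push_cast
    ring
  rw [key]
  ring

/-! ### The assembled angular data -/

/-- **Angular data from a zero of the shooting function.** Let `m ≠ 0`, `m₀ = |m|`, and let `ν` be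
a zero of the spheroidal shooting function at spheroidicity `κ = a²(ω² − μ²)`:
`sphmDer m₀ ν κ 1 = 0`. Then with `Λ = ν + m₀(m₀ + 1)`, `S(θ) = sin^{m₀} θ · E(cos θ)` and
`Y` as above: `IsAngularSolution a ω μ m Λ S` (SR (2.1) on `(0, π)` with genuine derivatives),
`IsSphericalExtension m S Y` (`e^{imφ}S` extends smoothly to `𝕊²`), and `S ≢ 0` on `(0, π)`.
Shlapentokh-Rothman, CMP 329 (2014), §2 and App. B. [cite: ShlapentokhRothman2014KleinGordon, §2 (2.1)] -/
theorem angularData_of_shooting_zero (a : ℝ) (w : ℂ) (μ : ℝ) {m : ℤ} (hm : m ≠ 0) {ν : ℂ}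
    (hg : sphmDer m.natAbs ν (((a ^ 2 : ℝ) : ℂ) * (w ^ 2 - ((μ ^ 2 : ℝ) : ℂ))) 1 = 0) :
    ∃ (S : ℝ → ℂ) (Y : E3 → ℂ),
      IsAngularSolution a w μ m (ν + (m.natAbs : ℂ) * ((m.natAbs : ℂ) + 1)) S ∧ IsSphericalExtension m S Y ∧
        ∃ θ ∈ Ioo 0 π, S θ ≠ 0 := by
  set m₀ : ℕ := m.natAbs with hm₀
  set κ : ℂ := ((a ^ 2 : ℝ) : ℂ) * (w ^ 2 - ((μ ^ 2 : ℝ) : ℂ)) with hκ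
  -- the sign `s` of `m` and `s · m₀ = m`
  obtain ⟨s, hs, hsm⟩ : ∃ s : ℝ, (s = 1 ∨ s = -1) ∧ s * (m₀ : ℝ) = (m : ℝ) := by
    have hcast : ((m₀ : ℕ) : ℝ) = ((m₀ : ℤ) : ℝ) := (Int.cast_natCast m₀).symm
    rcases lt_or_gt_of_ne hm with h | h
    · refine ⟨-1, Or.inr rfl, ?_⟩
      rw [hcast, hm₀, Int.ofNat_natAbs_of_nonpos h.le]
      push_cast
      ring
    · refine ⟨1, Or.inl rfl, ?_⟩
      rw [hcast, hm₀, Int.natAbs_of_nonneg h.le]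
      ring
  have hm₀sq : ((m : ℝ) : ℂ) ^ 2 = (m₀ : ℂ) ^ 2 := by
    have h2 : (m : ℝ) ^ 2 = ((m₀ : ℕ) : ℝ) ^ 2 := by
      rw [← hsm, mul_pow]
      rcases hs with h | h <;> simp [h]
    have h3 : ((m : ℝ) : ℂ) ^ 2 = (((m : ℝ) ^ 2 : ℝ) : ℂ) := by push_cast; ring
    rw [h3, h2]
    push_cast
    ring
  refine ⟨sphmAng m₀ ν κ, angY m₀ s ν κ, ⟨(contDiff_sphmAng hg).contDiffOn, fun θ hθ ↦ ?_⟩,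
    ⟨contDiffOn_angY hg s, fun v hv t ht ↦ angY_smul m₀ s ν κ hv ht, fun θ _ φ ↦ ?_⟩, exists_sphmAng_ne_zero hg⟩
  · -- SR (2.1): align the casts with `sphmAng_ode`
    have hode := sphmAng_ode hg hθ
    have hcast1 : ((((m : ℝ) ^ 2 / Real.sin θ ^ 2 : ℝ)) : ℂ) = (m₀ : ℂ) ^ 2 / (Real.sin θ : ℂ) ^ 2 := by
      rw [Complex.ofReal_div, Complex.ofReal_pow, Complex.ofReal_pow, ← hm₀sq]
    have hcast2 : ((Real.cos θ ^ 2 : ℝ) : ℂ) = (Real.cos θ : ℂ) ^ 2 := Complex.ofReal_pow _ _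
    rw [hcast1, hcast2]
    convert hode using 3
  · rw [angY_sphRadial m₀ hs, hsm]

end Literature.Barriers.FinalStateConjecture

end
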